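import Literature.Barriers.Parity.SiegelZeroDichotomyPairHL
import Literature.NumberTheory.LFunctions.HeathBrownPrimeTwinsSiegelZeros
import Mathlib.Analysis.SpecialFunctions.Pow.Asymptotics
import HarnessLib

/-!
# The hybrid Hardy–Littlewood–Chowla asymptotic under a Siegel zero (Tao–Teräväinen 2022,
# Theorem 1.6), with its two printed corollaries recovered in the kernel

Statement layer for the «illusory world» column, topics «twin primes / prime pairs» (I.4) and
«Chowla / Liouville correlations» (I.5). Source: T. Tao, J. Teräväinen, *The Hardy–Littlewood–Chowla
conjecture in the presence of a Siegel zero*, J. London Math. Soc. (2) 106 (2022) 3317–3378 =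
arXiv:2109.06291 (held) [TaoTeravainen2021], §1: Conjecture 1.3, (1.1), Definition 1.4, Theorem 1.6
with (1.5)–(1.6), Remark 1.7, Corollary 1.8; §2.1 (conventions); §8 (first paragraph).

The tree types the two COROLLARIES 1.8 (i) (`TaoTeravainen2021_pairHL`, `k = 2, ℓ = 0`) and
1.8 (ii) (`TaoTeravainen2021_chowla`, `k = 0`) as named facts; the MAIN THEOREM 1.6 — the HYBRID
correlations `𝔼 Λ(n+h₁)⋯Λ(n+h_k) λ(n+h′₁)⋯λ(n+h′_ℓ)` for `0 ≤ k ≤ 2`, `ℓ ≥ 0` (e.g.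
`𝔼_{n ≤ x} Λ(n)λ(n+1) = o(1)`, the `k = 1, ℓ = 1` hybrid of the prime number theorem and Chowla) —
is typed here, and the two corollaries are DERIVED from it in the kernel.

## What the source prints (§1)

(1.1): `𝔖 = ∏_p β_p`, `β_p = (1 − 1/p)^{−k}(1 − |{h₁,…,h_k} (mod p)|/p)`. **Conjecture 1.3**
(Hardy–Littlewood–Chowla). "Let `k, ℓ ≥ 0`, and let `h₁,…,h_k, h′₁,…,h′_ℓ` be distinct fixed
natural numbers. Then `𝔼_{n ≤ x} Λ(n+h₁)⋯Λ(n+h_k)λ(n+h′₁)⋯λ(n+h′_ℓ) = 𝔖 + o(1)` as `x → ∞`, where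
`𝔖` is defined by (1.1) when `ℓ > 0` [sic — read `ℓ = 0`: §8 "the easy case `ℓ > 0`, in which `𝔖`
vanishes", and Corollary 1.8 (ii) has main term `0`; the typed `hlcMainTerm` follows §8] and is equal
to zero otherwise." **Theorem 1.6** (New results on Hardy–Littlewood–Chowla given a Siegel zero).
"Let `0 ≤ k ≤ 2` and `ℓ ≥ 0`, and let `h₁,…,h_k,h′₁,…,h′_ℓ` be fixed distinct natural numbers.
Suppose that one has a Siegel zero `β` with associated conductor `q_χ` and quality `η`. Let
`0 < ε₀ < 1` be fixed, and let `x` lie in the range (1.5) `q_χ^{10k + 1/2 + ε₀} ≤ x ≤ q_χ^{η^{1/2}}`.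
Then we have (1.6) `𝔼_{n ≤ x} Λ(n+h₁)⋯Λ(n+h_k)λ(n+h′₁)⋯λ(n+h′_ℓ) = 𝔖 + O(1/log^{1/(10 max(1,k))} η)`
where `𝔖` is as in Conjecture 1.3." §2.1: implied constants may depend on the fixed quantities
(`h`, `h′`, `ε₀`) and be ineffective; "We will also assume that `η` is sufficiently large depending
on the fixed quantities" (absorbed in `C`: for bounded `η` the window is bounded too, cf. the
tree's typing of Corollary 1.8). **Corollary 1.8**: (i) `k = 2, ℓ = 0`: the pair Hardy–Littlewood
asymptotic with error `O(log^{−1/20} η)` on `q^{41/2+ε₀} ≤ x ≤ q^{√η}`; (ii) `k = 0`: Chowla with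
`O(log^{−1/10} η)` on `q^{1/2+ε₀} ≤ x ≤ q^{√η}`.

## Contents

* `TaoTeravainen2021.mixedAverage H H′ x` — `𝔼_{n ≤ x} ∏_{h ∈ H} Λ(n+h) ∏_{h′ ∈ H′} λ(n+h′)`
  (shift sets as finsets: "distinct"), extending the tree's `vonMangoldtPairAverage` (`H = {h₁,h₂}`,
  `H′ = ∅`) and `liouvilleTupleAverage` (`H = ∅`); `TaoTeravainen2021.hlcMainTerm H H′` — `𝔖` of
  Conjecture 1.3 (the tree's `Literature.NumberTheory.Sieve.singularSeries` of `H` if `H′ = ∅`,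
  else `0`);
* `taoTeravainen2021_theorem16` — NAMED FACT, Theorem 1.6 AS PRINTED (`|H| ≤ 2`, `H`, `H′` disjoint,
  shifts `≥ 1` as in the tree's typing of Corollary 1.8);
* PROVED: `TaoTeravainen2021.pairHL_of_theorem16 : taoTeravainen2021_theorem16 →
  TaoTeravainen2021_pairHL` and `TaoTeravainen2021.chowla_of_theorem16 : taoTeravainen2021_theorem16 →
  TaoTeravainen2021_chowla` — the two tree facts are the cases `(k,ℓ) = (2,0)` and `k = 0` of the
  new one (so `SiegelZeroTwinPrimes`, `robustChowlaFailure_eliminates`, … all follow from Theorem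
  1.6 alone); `TaoTeravainen2021.hybrid_one_one_of_theorem16` — the genuinely hybrid reading
  `𝔼_{n ≤ x} Λ(n+h)λ(n+h′) = O(log^{−1/10} η)` on `q^{21/2+ε₀} ≤ x ≤ q^{√η}`.

LABEL: instrument / statement layer. WHAT THIS IS NOT: no claim that Siegel zeros exist; Conjecture
1.3 itself stays open; nothing here bears on parity.

## References

* [TaoTeravainen2021] T. Tao, J. Teräväinen, J. London Math. Soc. (2) 106 (2022) 3317–3378 =
  arXiv:2109.06291: §1 (1.1), Conjecture 1.3, Definition 1.4, Theorem 1.6 (1.5)–(1.6), Remark 1.7,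
  Corollary 1.8; §2.1; §8 (first paragraph).
-/

noncomputable section

open Finset Real
open scoped ArithmeticFunction.vonMangoldt
open Literature.Barriers.Parity

namespace Literature.NumberTheory.LFunctions

namespace TaoTeravainen2021

/-- `𝔼_{n ≤ x} ∏_{h ∈ H} Λ(n+h) · ∏_{h′ ∈ H′} λ(n+h′)` — the hybrid correlation of §1's statement 1.3 / Theorem 1.6 (average over `1 ≤ n ≤ x`). [cite: TaoTeravainen2021, §1 (1.3) and (1.6)] -/
def mixedAverage (H H' : Finset ℕ) (x : ℕ) : ℝ :=
  (∑ n ∈ Icc 1 x, (∏ h ∈ H, Λ (n + h)) *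
      ∏ h' ∈ H', (ArithmeticFunction.liouville (n + h') : ℝ)) / x

/-- The main term `𝔖` of §1's hybrid statement (1.3): the singular series (1.1) of the `Λ`-shifts when there is
no Liouville factor, and `0` otherwise (§8: "the easy case `ℓ > 0`, in which `𝔖` vanishes").
[cite: TaoTeravainen2021, §1 (1.1), (1.3) and §8] -/
def hlcMainTerm (H H' : Finset ℕ) : ℝ :=
  if H' = ∅ then Literature.NumberTheory.Sieve.singularSeries (H.image (fun h : ℕ => (h : ℤ))) else 0

end TaoTeravainen2021

open TaoTeravainen2021 in
/-- **Tao–Teräväinen 2022, Theorem 1.6** (NAMED FACT, AS PRINTED): for disjoint finite sets of shifts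
`H` (`|H| = k ≤ 2`, von Mangoldt) and `H′` (Liouville), all shifts `≥ 1`, and fixed `0 < ε₀ < 1`,
there is `C` such that for every Siegel zero of quality `η` attached to `χ` mod `q` and every
`q^{10k + 1/2 + ε₀} ≤ x ≤ q^{√η}`:
`|𝔼_{n ≤ x} ∏_{h∈H} Λ(n+h) ∏_{h′∈H′} λ(n+h′) − 𝔖| ≤ C / log^{1/(10 max(1,k))} η`. Not proved here.
[cite: TaoTeravainen2021, §1 Theorem 1.6 with (1.5), (1.6), (1.3) and §2.1] -/
def taoTeravainen2021_theorem16 : Prop :=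
  ∀ H H' : Finset ℕ, H.card ≤ 2 → Disjoint H H' → (∀ h ∈ H, 1 ≤ h) → (∀ h ∈ H', 1 ≤ h) →
    ∀ ε₀ : ℝ, 0 < ε₀ → ε₀ < 1 →
      ∃ C : ℝ, ∀ (q : ℕ) [NeZero q] (χ : DirichletCharacter ℂ q) (η : ℝ), IsSiegelZero χ η →
        ∀ x : ℕ, (q : ℝ) ^ (10 * (H.card : ℝ) + 1 / 2 + ε₀) ≤ x → (x : ℝ) ≤ (q : ℝ) ^ Real.sqrt η →
          |mixedAverage H H' x - hlcMainTerm H H'| ≤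
            C / Real.log η ^ (1 / (10 * max (1 : ℝ) (H.card : ℝ)))

namespace TaoTeravainen2021

/-- With no Liouville shifts and `H = {h₁, h₂}` (`h₁ ≠ h₂`) the hybrid average is the tree's pair
average `𝔼_{n ≤ x} Λ(n+h₁)Λ(n+h₂)`. [cite: TaoTeravainen2021, §1 (1.6) and Corollary 1.8 (i)] -/
theorem mixedAverage_pair_empty {h₁ h₂ : ℕ} (hne : h₁ ≠ h₂) (x : ℕ) :
    mixedAverage {h₁, h₂} ∅ x = vonMangoldtPairAverage h₁ h₂ x := by
  unfold mixedAverage vonMangoldtPairAverage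
  congr 1
  refine Finset.sum_congr rfl fun n _ => ?_
  rw [Finset.prod_empty, mul_one, Finset.prod_pair hne]

/-- With no von Mangoldt shifts the hybrid average is the tree's Liouville tuple average.
[cite: TaoTeravainen2021, §1 (1.6) and Corollary 1.8 (ii)] -/
theorem mixedAverage_empty (H' : Finset ℕ) (x : ℕ) :
    mixedAverage ∅ H' x = liouvilleTupleAverage H' x := by
  unfold mixedAverage liouvilleTupleAverage
  simp only [Finset.prod_empty, one_mul]

/-- **Corollary 1.8 (i) from Theorem 1.6** (PROVED): the tree's named fact
`TaoTeravainen2021_pairHL` is the case `H = {h₁,h₂}`, `H′ = ∅` (`k = 2`: window exponent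
`10·2 + 1/2 = 41/2`, error exponent `1/(10·2) = 1/20`, `𝔖 = 𝔖({h₁,h₂})`).
[cite: TaoTeravainen2021, §1 Corollary 1.8 (i)] -/
theorem pairHL_of_theorem16 (h : taoTeravainen2021_theorem16) : TaoTeravainen2021_pairHL := by
  intro h₁ h₂ hh₁ hh₂ hne ε₀ hε₀ hε₁
  have hcard : ({h₁, h₂} : Finset ℕ).card = 2 := Finset.card_pair hne
  obtain ⟨C, hC⟩ := h {h₁, h₂} ∅ (by rw [hcard]) (Finset.disjoint_empty_right _)
    (by intro k hk; simp only [Finset.mem_insert, Finset.mem_singleton] at hk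
        rcases hk with rfl | rfl <;> assumption)
    (by simp) ε₀ hε₀ hε₁
  refine ⟨C, fun q _ χ η hS x hlo hhi => ?_⟩
  have h' := hC q χ η hS x (by rw [hcard]; push_cast; norm_num; exact hlo) hhi
  rw [mixedAverage_pair_empty hne, hcard] at h'
  have hmain : hlcMainTerm {h₁, h₂} ∅ =
      Literature.NumberTheory.Sieve.singularSeries ({(h₁ : ℤ), (h₂ : ℤ)} : Finset ℤ) := by
    simp [hlcMainTerm, Finset.image_insert, Finset.image_singleton]
  rw [hmain] at h'
  have hexp : (1 : ℝ) / (10 * max (1 : ℝ) ((2 : ℕ) : ℝ)) = 1 / 20 := by norm_num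
  rw [hexp] at h'
  exact h'

/-- **Corollary 1.8 (ii) from Theorem 1.6** (PROVED): the tree's named fact
`TaoTeravainen2021_chowla` is the case `H = ∅` (`k = 0`: window exponent `1/2 + ε₀`, error exponent
`1/10`, `𝔖 = 0` as `H′ ≠ ∅`). [cite: TaoTeravainen2021, §1 Corollary 1.8 (ii)] -/
theorem chowla_of_theorem16 (h : taoTeravainen2021_theorem16) : TaoTeravainen2021_chowla := by
  intro H' hH' hpos ε₀ hε₀ hε₁
  obtain ⟨C, hC⟩ := h ∅ H' (by simp) (Finset.disjoint_empty_left _) (by simp) hpos ε₀ hε₀ hε₁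
  refine ⟨C, fun q _ χ η hS x hlo hhi => ?_⟩
  have h' := hC q χ η hS x (by simp only [Finset.card_empty, Nat.cast_zero, mul_zero, zero_add]; exact hlo) hhi
  rw [mixedAverage_empty] at h'
  have hmain : hlcMainTerm ∅ H' = 0 := by
    simp [hlcMainTerm, Finset.nonempty_iff_ne_empty.mp hH']
  rw [hmain, sub_zero] at h'
  have hexp : (1 : ℝ) / (10 * max (1 : ℝ) ((0 : ℕ) : ℝ)) = 1 / 10 := by norm_num
  simp only [Finset.card_empty] at h'
  rw [hexp] at h'
  exact h'

/-- **The hybrid case `k = ℓ = 1`** (PROVED reading of Theorem 1.6): for shifts `h ≠ h′` (`≥ 1`) and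
`0 < ε₀ < 1` there is `C` with `|𝔼_{n ≤ x} Λ(n+h) λ(n+h′)| ≤ C/log^{1/10} η` for every Siegel zero
of quality `η` at `q` and every `q^{21/2+ε₀} ≤ x ≤ q^{√η}` — the prime number theorem twisted by a
shifted Liouville sign, on the scales attached to the zero. [cite: TaoTeravainen2021, §1 Theorem 1.6 (k = ℓ = 1)] -/
theorem hybrid_one_one_of_theorem16 (h : taoTeravainen2021_theorem16) {a b : ℕ} (ha : 1 ≤ a)
    (hb : 1 ≤ b) (hab : a ≠ b) {ε₀ : ℝ} (hε₀ : 0 < ε₀) (hε₁ : ε₀ < 1) :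
    ∃ C : ℝ, ∀ (q : ℕ) [NeZero q] (χ : DirichletCharacter ℂ q) (η : ℝ), IsSiegelZero χ η →
      ∀ x : ℕ, (q : ℝ) ^ ((21 : ℝ) / 2 + ε₀) ≤ x → (x : ℝ) ≤ (q : ℝ) ^ Real.sqrt η →
        |(∑ n ∈ Icc 1 x, Λ (n + a) * (ArithmeticFunction.liouville (n + b) : ℝ)) / x| ≤
          C / Real.log η ^ ((1 : ℝ) / 10) := by
  obtain ⟨C, hC⟩ := h {a} {b} (by simp) (by simpa using hab) (by simpa using ha) (by simpa using hb)
    ε₀ hε₀ hε₁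
  refine ⟨C, fun q _ χ η hS x hlo hhi => ?_⟩
  have h' := hC q χ η hS x
    (by simp only [Finset.card_singleton, Nat.cast_one, mul_one]; norm_num; exact hlo) hhi
  have havg : mixedAverage {a} {b} x =
      (∑ n ∈ Icc 1 x, Λ (n + a) * (ArithmeticFunction.liouville (n + b) : ℝ)) / x := by
    simp [mixedAverage]
  have hmain : hlcMainTerm {a} {b} = 0 := by simp [hlcMainTerm]
  rw [havg, hmain, sub_zero] at h'
  have hexp : (1 : ℝ) / (10 * max (1 : ℝ) ((1 : ℕ) : ℝ)) = 1 / 10 := by norm_num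
  simp only [Finset.card_singleton] at h'
  rw [hexp] at h'
  exact h'


/-! ### Heath-Brown's Theorem 1 (as typed from Theorem 1.5 (i)) is a corollary of Theorem 1.6
(appended 2026-08-26) -/

/-- `log log η ≤ (log η)^{1/20}` for all large `η` (since `log u = o(u^{1/20})`). [folklore] -/
private theorem eventually_loglog_le_rpow :
    ∃ η₀ : ℝ, ∀ η : ℝ, η₀ ≤ η → Real.log (Real.log η) ≤ Real.log η ^ ((1 : ℝ) / 20) := by
  have hsmall : ∀ᶠ u : ℝ in Filter.atTop, ‖Real.log u‖ ≤ 1 * ‖u ^ ((1 : ℝ) / 20)‖ :=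
    (isLittleO_log_rpow_atTop (by norm_num : (0 : ℝ) < 1 / 20)).def one_pos
  have hev : ∀ᶠ η : ℝ in Filter.atTop,
      ‖Real.log (Real.log η)‖ ≤ 1 * ‖Real.log η ^ ((1 : ℝ) / 20)‖ ∧ 1 ≤ Real.log η :=
    (Real.tendsto_log_atTop.eventually hsmall).and
      (Real.tendsto_log_atTop.eventually (Filter.eventually_ge_atTop 1))
  obtain ⟨η₀, hη₀⟩ := Filter.eventually_atTop.mp hev
  refine ⟨η₀, fun η hη => ?_⟩
  obtain ⟨h1, h2⟩ := hη₀ η hη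
  have hpos : 0 ≤ Real.log η ^ ((1 : ℝ) / 20) := Real.rpow_nonneg (by linarith) _
  rw [one_mul, Real.norm_of_nonneg hpos] at h1
  exact (le_abs_self _).trans ((Real.norm_eq_abs _).symm.le.trans h1)

/-- **Heath-Brown's Theorem 1, in the typed form `heathBrown1983_theorem1` (Tao–Teräväinen's
restatement, Theorem 1.5 (i)), FOLLOWS from Theorem 1.6** (PROVED): for `η ≥ max(300², η₁)` the
window `[q^{250}, q^{300}]` lies inside (1.5) (`41/2 + 1/2 ≤ 250`, `300 ≤ √η`) and the error
`C/log^{1/20} η` is `≤ C′/log log η` once `log log η ≤ log^{1/20} η`; Tao–Teräväinen: Theorem 1.6 is a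
"common generalization and strengthening" of Theorem 1.5. So the column's I.4 facts
`heathBrown1983_theorem1`, `TaoTeravainen2021_pairHL` and the I.5 fact `TaoTeravainen2021_chowla` all
descend from `taoTeravainen2021_theorem16`. [cite: TaoTeravainen2021, §1 Theorems 1.5 (i), 1.6 and Corollary 1.8] -/
theorem heathBrown1983_of_theorem16 (h : taoTeravainen2021_theorem16) : heathBrown1983_theorem1 := by
  intro h₁ h₂ hh₁ hh₂ hne
  obtain ⟨C, hC⟩ := pairHL_of_theorem16 h h₁ h₂ hh₁ hh₂ hne (1 / 2) (by norm_num) (by norm_num)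
  obtain ⟨η₁, hη₁⟩ := eventually_loglog_le_rpow
  -- `C` may be negative in principle; use `|C|`
  refine ⟨max (300 ^ 2) (max η₁ 3), |C|, fun q _ χ η hS hη x hlo hhi => ?_⟩
  have hη300 : (300 : ℝ) ^ 2 ≤ η := le_trans (le_max_left _ _) hη
  have hηη₁ : η₁ ≤ η := le_trans (le_trans (le_max_left _ _) (le_max_right _ _)) hη
  have hη3 : (3 : ℝ) ≤ η := le_trans (le_trans (le_max_right _ _) (le_max_right _ _)) hη
  have hq1 : (1 : ℝ) ≤ q := by exact_mod_cast NeZero.one_le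
  -- the window: `q^{41/2 + 1/2} ≤ q^{250} ≤ x` and `x ≤ q^{300} ≤ q^{√η}`
  have hlo' : (q : ℝ) ^ ((41 : ℝ) / 2 + 1 / 2) ≤ x :=
    le_trans (Real.rpow_le_rpow_of_exponent_le hq1 (by norm_num)) hlo
  have hsqrt : (300 : ℝ) ≤ Real.sqrt η := by
    rw [show (300 : ℝ) = Real.sqrt (300 ^ 2) by rw [Real.sqrt_sq (by norm_num)]]
    exact Real.sqrt_le_sqrt hη300
  have hhi' : (x : ℝ) ≤ (q : ℝ) ^ Real.sqrt η :=
    le_trans hhi (Real.rpow_le_rpow_of_exponent_le hq1 hsqrt)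
  have hTT := hC q χ η hS x hlo' hhi'
  -- compare the error terms
  have hlog1 : 1 < Real.log η := by
    have : Real.log 3 ≤ Real.log η := Real.log_le_log (by norm_num) hη3
    have h3 : 1 < Real.log 3 := by
      rw [Real.lt_log_iff_exp_lt (by norm_num)]
      have := Real.exp_one_lt_d9; linarith
    linarith
  have hll0 : 0 < Real.log (Real.log η) := Real.log_pos hlog1
  have hpow0 : 0 < Real.log η ^ ((1 : ℝ) / 20) := Real.rpow_pos_of_pos (by linarith) _
  have hcmp : Real.log (Real.log η) ≤ Real.log η ^ ((1 : ℝ) / 20) := hη₁ η hηη₁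
  calc |vonMangoldtPairAverage h₁ h₂ x -
          Literature.NumberTheory.Sieve.singularSeries ({(h₁ : ℤ), (h₂ : ℤ)} : Finset ℤ)|
      ≤ C / Real.log η ^ ((1 : ℝ) / 20) := hTT
    _ ≤ |C| / Real.log η ^ ((1 : ℝ) / 20) := div_le_div_of_nonneg_right (le_abs_self C) hpow0.le
    _ ≤ |C| / Real.log (Real.log η) := div_le_div_of_nonneg_left (abs_nonneg C) hll0 hcmp

end TaoTeravainen2021

end Literature.NumberTheory.LFunctions

end
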